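import Summits.AtomisticToContinuum.HydrodynamicLimit.Theorems.JParityClosureLocalSecondLawLedgerDefs

/-!
# Ensemble vocabulary of the line `contact-asymmetry-information` for the crux `LocalSecondLaw`
(stmt-AtomisticToContinuum-13081) — part A: pinned cells, mean fields, ensemble functional, frames

Theorems-side copy (texts byte-identical, only the namespace differs) of the ENSEMBLE OBJECTS and FRAMES of the registered
skeleton `Cruxes/LocalSecondLaw/Lines/contact_asymmetry_information.lean`: coarse history centres `Centre`, pinned cells
`Pin` (`Pin_mono`), the conditioned law `condLaw`, mean coarse fields `rhoBar/momBar/kinBar/thetaBar/uBar`, the ensemble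
crux functional `ensFunctional = ensT + ensX`, slice-wise one-particle densities `IsOneParticleDensity`, kinetic entropy
`h1/j1` and their cone smearings `hBar/jBar`, the smeared Résibois density/flux `hKinBar/jKinBar`, the kinetic weak form
`kinWeakForm`, the three gaps `maxwellGapEns/fluxGapEns/initialGapEns` with the `ring` ledger `ensFunctional_add_init_eq`
(registered anchor `contactDefs_ledger`), and the two quantifier frames `EnsFrame`, `EnsFrameK`.  Stubs T, Q, M, K4, B′ of
the line are statements over this file alone; the contact-bundle objects (stubs S, K1) live in part C
(`…ContactBundle.lean`), the abstract kernel in part B (`…ContactKernel.lean`).  The registered stub texts (`Stubs.*`) stay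
in the skeleton; stub proofs under `Theorems/` prove registered expanded-text twins over this vocabulary.

References: H. Spohn, *Large Scale Dynamics of Interacting Particles* (1991), Part I §3; P. Résibois, J. Stat. Phys. 19
(1978) 593.  Lead seat prover-line-stmt-AtomisticToContinuum-13081-a5-0 (vocabulary landing; texts by the crux-plan seat).
-/

noncomputable section

open scoped BigOperators Topology Classical MeasureTheory ENNReal InnerProductSpace
open Filter Set MeasureTheory Function
open Literature.MathematicalPhysics.KineticTheory
open Literature.Analysis.FluidPDE
open Summit.AtomisticToContinuum.HydrodynamicLimit.Theorems.LocalSecondLawNegative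
open Summit.AtomisticToContinuum.HydrodynamicLimit.Theorems.LocalSecondLawLedger

namespace Summit.AtomisticToContinuum.HydrodynamicLimit.Theorems.LocalSecondLawContact

variable {N : ℕ}

/-- A coarse HISTORY CENTRE: a deterministic candidate for the coarse fields `(ρ_r, m_r, e_r)(s, x)`. -/
abbrev Centre : Type := ℝ → T3 → ℝ × V3 × ℝ

/-- The PINNED CELL of a centre at resolution `η′`: phase points whose coarse history `s ↦ (ρ_r, m_r, e_r)(Φₛz)` stays
within `η′` of the centre in sup-norm on `[0,τ] × 𝕋³`. -/
def Pin (σ r τ η' : ℝ) (Φ : Flow σ N) (c : Centre) : Set (Phase N) :=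
  {z | ∀ s ∈ Set.Icc (0 : ℝ) τ, ∀ x : T3,
      |rhoC r (Φ.flow s z) x - (c s x).1| ≤ η' ∧ ‖momC r (Φ.flow s z) x - (c s x).2.1‖ ≤ η' ∧
        |kinC r (Φ.flow s z) x - (c s x).2.2| ≤ η'}

/-- Pinned cells are monotone in the resolution. -/
theorem Pin_mono {σ r τ η₁ η₂ : ℝ} (h : η₁ ≤ η₂) (Φ : Flow σ N) (c : Centre) :
    Pin σ r τ η₁ Φ c ⊆ Pin σ r τ η₂ Φ c := by
  intro z hz s hs x
  obtain ⟨h1, h2, h3⟩ := hz s hs x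
  exact ⟨h1.trans h, h2.trans h, h3.trans h⟩

/-- The CONDITIONED LAW `μ(· | S) = μ(S)⁻¹ · μ|_S` (a bounded tilt of `μ` when `μ(S)` is bounded below). -/
def condLaw (μ : Measure (Phase N)) (S : Set (Phase N)) : Measure (Phase N) :=
  (μ S)⁻¹ • μ.restrict S

/-- Mean coarse density `ρ̄(s,x) = E_ν[ρ_r(Φₛz)(x)]` of a law `ν`. -/
def rhoBar (r : ℝ) (ν : Measure (Phase N)) {σ : ℝ} (Φ : Flow σ N) (s : ℝ) (x : T3) : ℝ :=
  ∫ z, rhoC r (Φ.flow s z) x ∂ν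

/-- Mean coarse momentum `m̄(s,x) = E_ν[m_r(Φₛz)(x)]`. -/
def momBar (r : ℝ) (ν : Measure (Phase N)) {σ : ℝ} (Φ : Flow σ N) (s : ℝ) (x : T3) : V3 :=
  ∫ z, momC r (Φ.flow s z) x ∂ν

/-- Mean coarse kinetic energy `ē(s,x) = E_ν[e_r(Φₛz)(x)]`. -/
def kinBar (r : ℝ) (ν : Measure (Phase N)) {σ : ℝ} (Φ : Flow σ N) (s : ℝ) (x : T3) : ℝ :=
  ∫ z, kinC r (Φ.flow s z) x ∂ν

/-- Mean coarse temperature `θ̄ = (2/3)(ē/ρ̄ − |m̄|²/(2ρ̄²))` (the crux's formula at the mean fields; junk `0/0 = 0`). -/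
def thetaBar (r : ℝ) (ν : Measure (Phase N)) {σ : ℝ} (Φ : Flow σ N) (s : ℝ) (x : T3) : ℝ :=
  2 / 3 * (kinBar r ν Φ s x / rhoBar r ν Φ s x - ‖momBar r ν Φ s x‖ ^ 2 / (2 * rhoBar r ν Φ s x ^ 2))

/-- Mean coarse velocity `ū = m̄/ρ̄`, componentwise, with the crux's junk convention. -/
def uBar (r : ℝ) (ν : Measure (Phase N)) {σ : ℝ} (Φ : Flow σ N) (s : ℝ) (x : T3) (k : Fin 3) : ℝ :=
  (momBar r ν Φ s x) k / rhoBar r ν Φ s x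

/-- Time part of the ENSEMBLE crux functional: `∫₀^τ ∫ Hs(ρ̄, θ̄) ∂ₛφ dx ds`. -/
def ensT (σ r τ : ℝ) (φ : ℝ → T3 → ℝ) (ν : Measure (Phase N)) (Φ : Flow σ N) : ℝ :=
  ∫ s in Set.Icc (0 : ℝ) τ, ∫ x : T3,
    Hs σ (rhoBar r ν Φ s x) (thetaBar r ν Φ s x) * deriv (fun s' => φ s' x) s

/-- Transport part of the ENSEMBLE crux functional: `∫₀^τ ∫ Hs(ρ̄, θ̄) ū·∇φ dx ds`. -/
def ensX (σ r τ : ℝ) (φ : ℝ → T3 → ℝ) (ν : Measure (Phase N)) (Φ : Flow σ N) : ℝ :=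
  ∫ s in Set.Icc (0 : ℝ) τ, ∫ x : T3,
    Hs σ (rhoBar r ν Φ s x) (thetaBar r ν Φ s x) * ∑ k : Fin 3, uBar r ν Φ s x k * pD k (φ s) x

/-- **The ENSEMBLE crux functional** `𝓘[ν]` — the crux integrand at the MEAN coarse fields of `ν` (time part plus
transport part; a sum of two integrals by definition). -/
def ensFunctional (σ r τ : ℝ) (φ : ℝ → T3 → ℝ) (ν : Measure (Phase N)) (Φ : Flow σ N) : ℝ :=
  ensT σ r τ φ ν Φ + ensX σ r τ φ ν Φ

/-! ### One-particle density, kinetic entropy, the Résibois comparison density -/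

/-- One-particle phase point `ℝ × 𝕋³ × V3` (time, position, velocity). -/
abbrev Pt1 : Type := ℝ × T3 × V3

/-- `f` IS A (slice-wise) ONE-PARTICLE DENSITY of the law `ν` transported by `Φ` on `[0,τ]`: non-negative, jointly
measurable, and for EVERY `s ∈ [0,τ]` the density of the expected empirical one-particle measure at time `s` against
bounded measurable test functions (trace-free duality; a.e.-unique per slice). -/
def IsOneParticleDensity (τ : ℝ) (ν : Measure (Phase N)) {σ : ℝ} (Φ : Flow σ N) (f : Pt1 → ℝ) : Prop :=
  (∀ p, 0 ≤ f p) ∧ Measurable f ∧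
    ∀ s ∈ Set.Icc (0 : ℝ) τ, ∀ G : T3 × V3 → ℝ, Measurable G → (∃ C : ℝ, ∀ y, |G y| ≤ C) →
      Integrable (fun z => (N + 1 : ℝ)⁻¹ * ∑ i : Fin (N + 1), G (Φ.flow s z i)) ν ∧
        ∫ z, ((N + 1 : ℝ)⁻¹ * ∑ i : Fin (N + 1), G (Φ.flow s z i)) ∂ν = ∫ y : T3 × V3, G y * f (s, y)

/-- Kinetic entropy density `h₁(s, y) = ∫ f log f dv`. -/
def h1 (f : Pt1 → ℝ) (s : ℝ) (y : T3) : ℝ :=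
  ∫ v : V3, f (s, y, v) * Real.log (f (s, y, v))

/-- Kinetic entropy flux `j₁(s, y) = ∫ v f log f dv`, componentwise. -/
def j1 (f : Pt1 → ℝ) (s : ℝ) (y : T3) (k : Fin 3) : ℝ :=
  ∫ v : V3, f (s, y, v) * Real.log (f (s, y, v)) * v k

/-- Cone-smeared kinetic entropy `h̄ = b_r ∗ h₁` at the field point `x`. -/
def hBar (r : ℝ) (f : Pt1 → ℝ) (s : ℝ) (x : T3) : ℝ :=
  ∫ y : T3, cone r y x * h1 f s y

/-- Cone-smeared kinetic entropy flux `j̄ = b_r ∗ j₁`, componentwise. -/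
def jBar (r : ℝ) (f : Pt1 → ℝ) (s : ℝ) (x : T3) (k : Fin 3) : ℝ :=
  ∫ y : T3, cone r y x * j1 f s y k

/-- The Maxwellian entropy constant `c₀ = (3/2)(1 + log 2π)`: `∫ M log M = ρ log ρ − (3/2)ρ log θ − c₀ρ`. -/
def c0 : ℝ := 3 / 2 * (1 + Real.log (2 * Real.pi))

/-- The smeared Résibois/RET `H`-density of the law: `h̄_kin = b_r ∗ h₁ + c₀ρ̄ + ρ̄ f_ex(ρ̄σ³)` — the line's comparison
density for `Hs(ρ̄, θ̄)`; `Hs(ρ̄,θ̄) − h̄_kin = −[b_r∗h₁ − h(b_r∗ₓf)] − KL(b_r∗ₓf ‖ M) ≤ 0` on `{ρ̄ > 0}` (Jensen + Gibbs;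
the `f_ex` terms CANCEL). -/
def hKinBar (σ r : ℝ) (f : Pt1 → ℝ) (ν : Measure (Phase N)) (Φ : Flow σ N) (s : ℝ) (x : T3) : ℝ :=
  hBar r f s x + c0 * rhoBar r ν Φ s x +
    rhoBar r ν Φ s x * hsExcessFreeEnergy (rhoBar r ν Φ s x * σ ^ 3)

/-- The smeared Résibois `H`-flux `j̄_kin = b_r ∗ j₁ + (c₀ρ̄ + ρ̄ f_ex(ρ̄σ³)) ū`, componentwise. -/
def jKinBar (σ r : ℝ) (f : Pt1 → ℝ) (ν : Measure (Phase N)) (Φ : Flow σ N) (s : ℝ) (x : T3) (k : Fin 3) : ℝ :=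
  jBar r f s x k +
    (c0 * rhoBar r ν Φ s x + rhoBar r ν Φ s x * hsExcessFreeEnergy (rhoBar r ν Φ s x * σ ^ 3)) * uBar r ν Φ s x k

/-- **The kinetic weak form** `𝒦 = ∫∫ h̄_kin ∂ₛφ + ∫∫ j̄_kin·∇φ + ∫ h̄_kin(0,·)φ(0,·)` (three integrals). -/
def kinWeakForm (σ r τ : ℝ) (φ : ℝ → T3 → ℝ) (f : Pt1 → ℝ) (ν : Measure (Phase N)) (Φ : Flow σ N) : ℝ :=
  (∫ s in Set.Icc (0 : ℝ) τ, ∫ x : T3, hKinBar σ r f ν Φ s x * deriv (fun s' => φ s' x) s) +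
    (∫ s in Set.Icc (0 : ℝ) τ, ∫ x : T3, ∑ k : Fin 3, jKinBar σ r f ν Φ s x k * pD k (φ s) x) +
      ∫ x : T3, hKinBar σ r f ν Φ 0 x * φ 0 x

/-- Maxwellisation gap (time part of `𝓘` minus time part of `𝒦`): `∫∫ (Hs(ρ̄,θ̄) − h̄_kin) ∂ₛφ` morally. -/
def maxwellGapEns (σ r τ : ℝ) (φ : ℝ → T3 → ℝ) (f : Pt1 → ℝ) (ν : Measure (Phase N)) (Φ : Flow σ N) : ℝ :=
  ensT σ r τ φ ν Φ - ∫ s in Set.Icc (0 : ℝ) τ, ∫ x : T3, hKinBar σ r f ν Φ s x * deriv (fun s' => φ s' x) s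

/-- Entropy-flux gap (transport part of `𝓘` minus flux part of `𝒦`): `∫∫ (Hs ū − j̄_kin)·∇φ = ∫∫ [(H_id − h̄)ū − q̄_K]·∇φ`
morally — contains the conductive kinetic entropy flux, i.e. the CUBIC closure. -/
def fluxGapEns (σ r τ : ℝ) (φ : ℝ → T3 → ℝ) (f : Pt1 → ℝ) (ν : Measure (Phase N)) (Φ : Flow σ N) : ℝ :=
  ensX σ r τ φ ν Φ - ∫ s in Set.Icc (0 : ℝ) τ, ∫ x : T3, ∑ k : Fin 3, jKinBar σ r f ν Φ s x k * pD k (φ s) x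

/-- Initial matching gap `∫ Hs(ρ_E, θ_E)φ(0) − ∫ h̄_kin(0,·)φ(0,·)` against comparison data `ρ_E, θ_E` (the Euler datum
at `t = 0` in the composition). -/
def initialGapEns (σ r : ℝ) (φ : ℝ → T3 → ℝ) (f : Pt1 → ℝ) (ν : Measure (Phase N)) (Φ : Flow σ N)
    (ρE θE : T3 → ℝ) : ℝ :=
  (∫ x : T3, Hs σ (ρE x) (θE x) * φ 0 x) - ∫ x : T3, hKinBar σ r f ν Φ 0 x * φ 0 x

/-- **The ensemble ledger** — an identity of real numbers, true by `ring` (every gap is a difference of integrals). -/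
theorem ensFunctional_add_init_eq (σ r τ : ℝ) (φ : ℝ → T3 → ℝ) (f : Pt1 → ℝ) (ν : Measure (Phase N))
    (Φ : Flow σ N) (ρE θE : T3 → ℝ) :
    ensFunctional σ r τ φ ν Φ + ∫ x : T3, Hs σ (ρE x) (θE x) * φ 0 x =
      kinWeakForm σ r τ φ f ν Φ + maxwellGapEns σ r τ φ f ν Φ + fluxGapEns σ r τ φ f ν Φ +
        initialGapEns σ r φ f ν Φ ρE θE := by
  unfold ensFunctional kinWeakForm maxwellGapEns fluxGapEns initialGapEns
  ring

/-- Registered anchor of this vocabulary file (`contactDefs_ledger`): the ensemble ledger as a closed statement. -/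
theorem contactDefs_ledger : ∀ {N : ℕ} (σ r τ : ℝ) (φ : ℝ → T3 → ℝ) (f : Pt1 → ℝ) (ν : Measure (Phase N)) (Φ : Flow σ N) (ρE θE : T3 → ℝ), ensFunctional σ r τ φ ν Φ + ∫ x : T3, Hs σ (ρE x) (θE x) * φ 0 x = kinWeakForm σ r τ φ f ν Φ + maxwellGapEns σ r τ φ f ν Φ + fluxGapEns σ r τ φ f ν Φ + initialGapEns σ r φ f ν Φ ρE θE :=
  fun σ r τ φ f ν Φ ρE θE => ensFunctional_add_init_eq σ r τ φ f ν Φ ρE θE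

/-! ## § Frames of the line -/

/-- The ENSEMBLE FRAME: for all local-Gibbs profiles, `σ < σ₀(profiles)`, the crux's Euler data (used only through its
`t = 0` slice), all flows, horizons and admissible test functions, and every tolerance `η > 0`, there are a pinning
resolution `η′ > 0` and a radius `r₀ > 0` such that for `r < r₀` and every mass floor `δ″ > 0`, eventually in `N`, the
conclusion holds for EVERY set `S` of local-Gibbs mass `≥ δ″` pinned at resolution `η′` (i.e. for every bounded tilt
`P_N(·|S)`, `dP_N(·|S)/dP_N ≤ 1/δ″`, with pinned coarse histories).  Limit order `N → ∞` at FIXED `r`. -/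
def EnsFrame
    (concl : (σ r τ η : ℝ) → (φ : ℝ → T3 → ℝ) → (ρ θ : ℝ → T3 → ℝ) → (N : ℕ) → Flow σ N →
      Measure (Phase N) → Set (Phase N) → Prop) : Prop :=
  ∀ (a₀ θ₀ : T3 → ℝ) (u₀ : T3 → V3), Continuous a₀ → Continuous θ₀ → Continuous u₀ →
    (∀ x, 0 < a₀ x) → (∀ x, 0 < θ₀ x) →
    ∃ σ₀ : ℝ, 0 < σ₀ ∧ ∀ σ : ℝ, 0 < σ → σ < σ₀ →
      ∀ (T : ℝ) (ρ θ : ℝ → T3 → ℝ) (u : ℝ → T3 → V3), IsHardSphereEulerSolution σ T ρ u θ →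
        ∀ Φ : (N : ℕ) → Flow σ N,
          TendstoHydroFieldsAt (fun N => localGibbsLaw σ a₀ u₀ θ₀ N (Φ N)) Φ ρ u θ 0 → 0 < T →
            ∀ τ : ℝ, 0 < τ →
              ∀ φ : ℝ → T3 → ℝ, Literature.Analysis.FunctionSpaces.Torus.IsSmoothSpaceTimeOn Set.univ φ →
                (∀ s x, 0 ≤ φ s x) → (∃ τ' : ℝ, τ' < τ ∧ ∀ s, τ' ≤ s → ∀ x, φ s x = 0) →
                ∀ η : ℝ, 0 < η →
                  ∃ η' : ℝ, 0 < η' ∧ ∃ r₀ : ℝ, 0 < r₀ ∧ ∀ r : ℝ, 0 < r → r < r₀ →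
                    ∀ δ'' : ℝ, 0 < δ'' → ∃ N₀ : ℕ, ∀ N : ℕ, N₀ ≤ N →
                      ∀ S : Set (Phase N), ENNReal.ofReal δ'' ≤ localGibbsLaw σ a₀ u₀ θ₀ N (Φ N) S →
                        ∀ c : Centre, S ⊆ Pin σ r τ η' (Φ N) c →
                          concl σ r τ η φ ρ θ N (Φ N) (localGibbsLaw σ a₀ u₀ θ₀ N (Φ N)) S

/-- The ensemble frame WITH A CONTRAST LEVEL `κ < 1` FIXED RIGHT AFTER `σ` (so uniform in the Euler data, the flow, `τ`, `φ`, the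
tolerances, `r`, `N` and the cell): the shape of K1, whose mechanism is `κ = O(σ³)`. -/
def EnsFrameK
    (concl : (κ σ r τ η : ℝ) → (φ : ℝ → T3 → ℝ) → (ρ θ : ℝ → T3 → ℝ) → (N : ℕ) → Flow σ N →
      Measure (Phase N) → Set (Phase N) → Prop) : Prop :=
  ∀ (a₀ θ₀ : T3 → ℝ) (u₀ : T3 → V3), Continuous a₀ → Continuous θ₀ → Continuous u₀ →
    (∀ x, 0 < a₀ x) → (∀ x, 0 < θ₀ x) →
    ∃ σ₀ : ℝ, 0 < σ₀ ∧ ∀ σ : ℝ, 0 < σ → σ < σ₀ → ∃ κ : ℝ, κ < 1 ∧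
      ∀ (T : ℝ) (ρ θ : ℝ → T3 → ℝ) (u : ℝ → T3 → V3), IsHardSphereEulerSolution σ T ρ u θ →
        ∀ Φ : (N : ℕ) → Flow σ N,
          TendstoHydroFieldsAt (fun N => localGibbsLaw σ a₀ u₀ θ₀ N (Φ N)) Φ ρ u θ 0 → 0 < T →
            ∀ τ : ℝ, 0 < τ →
              ∀ φ : ℝ → T3 → ℝ, Literature.Analysis.FunctionSpaces.Torus.IsSmoothSpaceTimeOn Set.univ φ →
                (∀ s x, 0 ≤ φ s x) → (∃ τ' : ℝ, τ' < τ ∧ ∀ s, τ' ≤ s → ∀ x, φ s x = 0) →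
                ∀ η : ℝ, 0 < η →
                  ∃ η' : ℝ, 0 < η' ∧ ∃ r₀ : ℝ, 0 < r₀ ∧ ∀ r : ℝ, 0 < r → r < r₀ →
                    ∀ δ'' : ℝ, 0 < δ'' → ∃ N₀ : ℕ, ∀ N : ℕ, N₀ ≤ N →
                      ∀ S : Set (Phase N), ENNReal.ofReal δ'' ≤ localGibbsLaw σ a₀ u₀ θ₀ N (Φ N) S →
                        ∀ c : Centre, S ⊆ Pin σ r τ η' (Φ N) c →
                          concl κ σ r τ η φ ρ θ N (Φ N) (localGibbsLaw σ a₀ u₀ θ₀ N (Φ N)) S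

end Summit.AtomisticToContinuum.HydrodynamicLimit.Theorems.LocalSecondLawContact

end
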